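import Mathlib.Topology.Order.Basic
import Summits.CriticalPhenomena.CardyFormulaZ2.Theorems.CardyFlipRussoSquareFromVoronoiHubDecimationDefs
import Summits.CriticalPhenomena.CardyFormulaZ2.Theorems.CardyFlipRussoSquareFromVoronoiHubDecimateForward
import Summits.CriticalPhenomena.CardyFormulaZ2.Theorems.CardyFlipRussoSquareFromVoronoiHubDecimateBackward
import Summits.CriticalPhenomena.CardyFormulaZ2.Theorems.CardyFlipRussoSquareFromVoronoiHubDecimateMeasure
import Summits.CriticalPhenomena.CardyFormulaZ2.Theorems.CardyFlipRussoSquareFromVoronoiHubCrudeUpper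
import Literature.Probability.Percolation.BoxCrossingProofs
import HarnessLib

/-!
# The centre-decimation identity and the reduction of crux `SquareFromVoronoiHub` to the random-diagonal lattice

Assembly file of the line `centre-decimation` for the crux `SquareFromVoronoiHub`
(stmt-CriticalPhenomena-6434, route `CardyFlipRusso`, sub-problem `CardyFormulaZ2`; lead
`prover-line-stmt-CriticalPhenomena-6434-c1-0`).  Everything here is sorry-free; it assembles the
four landed stub files of wave 1.

* `centreDecimationIdentity` — **(CD)**: for all site windows `A`, admitted faces `B` and endpoint
  sets `U, V ⊆ ℤ²`, the probability under critical site percolation on the centred square lattice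
  `G_s` that some `u ∈ U` is joined to some `v ∈ V` by an open `G_s`-path inside
  `inl '' A ∪ inr '' B` EQUALS the probability of the same connection for fair site percolation on
  `ℤ²` with one independent fair diagonal per face of `B` (`diagLaw`, `diagGraph`).  Proof: the
  decimation map `decimate A` is a measure-preserving measurable equivalence
  (`stub_decimateMeasure`) carrying the one event onto the other (`stub_decimateForward`,
  `stub_decimateBackward`).
* `diagCrossingProb_two_le_siteCrossingProb`, `siteCrossingProb_le_diagCrossingProb_three` — the
  slack squeeze `diag(2δ) ≤ site(δ) ≤ diag(3δ)` (the second for `0 < δ`, `4δ < dist(arc 0, arc 2)`),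
  from (CD), the definitional lower inclusion and `stub_crudeUpper`.
* `gsCardy_of_randomDiagonalCardy` — Cardy's formula for the annealed random-diagonal square
  lattice at the two slacks `2δ`, `3δ` implies Cardy's formula for critical site percolation on
  `G_s` in the crux's crude discretisation (a `Tendsto` squeeze along `𝓝[>] 0`).
* `stub_crux_of_voronoiToRandomDiagonal` — the line's transferred crux C⁺ ("Cardy for annealed
  Poisson–Voronoi percolation ⇒ Cardy for the random-diagonal lattice at slacks 2 and 3") implies
  the crux `CardyFlipRusso.SquareFromVoronoiHub` BY NAME.  C⁺ itself (the crux's universality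
  content) is NOT proved here.

Sources: card `Cruxes/SquareFromVoronoiHub/Ideas/centre-decimation.md`; L. T. Rolla,
arXiv:1704.04930, §1 (the random-diagonal model); V. Beffara (2008), §5.1 (`G_s`).
-/

noncomputable section

open scoped Topology MeasureTheory
open Filter Set MeasureTheory
open Literature.Analysis.FunctionSpaces (PointConfig IsPoissonPointProcess)
open Literature.Probability.RandomPlanarGeometry (ConformalRectangle cardyFunction)
open Literature.Probability.Percolation (SiteConfig sitePercolation siteConnIn half)
open Summit.CriticalPhenomena.CardyFormulaZ2.Cruxes.SquareFromVoronoiHub.VoronoiBlocks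
  (zGs Gs crudeCrossing siteCrossingProb voronoiCrossingProb)

namespace Summit.CriticalPhenomena.CardyFormulaZ2.Cruxes.SquareFromVoronoiHub.CentreDecimation

/-! ### (CD) The centre-decimation identity -/

/-- Under `decimate A`, the `G_s` connection event is exactly the preimage of the random-diagonal
connection event (wave-1 stubs `stub_decimateForward`, `stub_decimateBackward`). [cite: Rolla2019, §1] -/
theorem gsConn_eq_preimage_diagConn (A B U V : Set (ℤ × ℤ)) :
    gsConn A B U V = decimate A ⁻¹' diagConn A B U V := by
  ext ω
  exact ⟨stub_decimateForward A B U V ω, stub_decimateBackward A B U V ω⟩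

/-- **The centre-decimation identity (CD).**  For all site windows `A`, admitted faces `B` and
endpoint sets `U, V ⊆ ℤ²`:
`P_{G_s, 1/2}[∃ u ∈ U, v ∈ V : inl u ↔ inl v inside inl '' A ∪ inr '' B]
 = P_{ζ ⊗ σ}[∃ u ∈ U, v ∈ V : u ↔ v inside A in ℤ² with the diagonals ζ|_B]`
— critical site percolation on the centred square lattice, read on its `ℤ²`-sites, IS fair site
percolation on the annealed random-diagonal square lattice. [cite: Rolla2019, §1] -/
theorem centreDecimationIdentity (A B U V : Set (ℤ × ℤ)) :
    (sitePercolation ((ℤ × ℤ) ⊕ (ℤ × ℤ)) half).real (gsConn A B U V) =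
      diagLaw.real (diagConn A B U V) := by
  rw [measureReal_def, measureReal_def, gsConn_eq_preimage_diagConn, stub_decimateMeasure]

/-! ### The slack squeeze -/

/-- Lower inclusion of the squeeze (definitional bookkeeping): a `G_s` connection between sites
within `2δ` of the arcs inside the window IS a crude crossing of the crux. [folklore] -/
theorem gsConn_two_subset_crudeCrossing (R : ConformalRectangle) (δ : ℝ) :
    gsConn (siteWindow R δ) (faceWindow R δ) (nearArc R 0 2 δ) (nearArc R 2 2 δ) ⊆
      crudeCrossing R δ := by
  rintro ω ⟨u, hu, v, hv, h⟩
  refine ⟨Sum.inl u, Sum.inl v, hu, hv, ?_⟩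
  rwa [stub_crudeUpperAux.window_eq]

/-- **Squeeze, lower bound**: `diag(2δ) ≤ site(δ)` for every mesh `δ`. [cite: Rolla2019, §1] -/
theorem diagCrossingProb_two_le_siteCrossingProb (R : ConformalRectangle) (δ : ℝ) :
    diagCrossingProb R 2 δ ≤ siteCrossingProb R δ := by
  unfold diagCrossingProb diagCrude siteCrossingProb
  rw [← centreDecimationIdentity]
  exact measureReal_mono (gsConn_two_subset_crudeCrossing R δ) (measure_ne_top _ _)

/-- **Squeeze, upper bound**: `site(δ) ≤ diag(3δ)` once `0 < δ` and `4δ < dist(arc 0, arc 2)`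
(wave-1 stub `stub_crudeUpper`). [cite: Rolla2019, §1] -/
theorem siteCrossingProb_le_diagCrossingProb_three (R : ConformalRectangle) {δ : ℝ} (hδ : 0 < δ)
    (hfar : ∀ a ∈ R.arc 0, ∀ b ∈ R.arc 2, 4 * δ < dist a b) :
    siteCrossingProb R δ ≤ diagCrossingProb R 3 δ := by
  unfold diagCrossingProb diagCrude siteCrossingProb
  rw [← centreDecimationIdentity]
  exact measureReal_mono (stub_crudeUpper R hδ hfar) (measure_ne_top _ _)

/-- **Cardy for the random-diagonal lattice at slacks `2` and `3` implies Cardy for critical site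
percolation on `G_s`** (crux conclusion, crude event), by the squeeze along `δ → 0⁺` (the arcs
`(ab)`, `(cd)` are at positive distance, `MarkedDomain.exists_pos_forall_lt_dist_arc`).
[cite: Rolla2019, §1] -/
theorem gsCardy_of_randomDiagonalCardy
    (h2 : ∀ R : ConformalRectangle, R.HasCrossingLimit (diagCrossingProb R 2) cardyFunction)
    (h3 : ∀ R : ConformalRectangle, R.HasCrossingLimit (diagCrossingProb R 3) cardyFunction) :
    ∀ R : ConformalRectangle, R.HasCrossingLimit (siteCrossingProb R) cardyFunction := by
  intro R φ x hux
  obtain ⟨ε, hε, hεd⟩ := R.exists_pos_forall_lt_dist_arc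
  have hlo : ∀ᶠ δ in 𝓝[>] (0 : ℝ), diagCrossingProb R 2 δ ≤ siteCrossingProb R δ :=
    Eventually.of_forall fun δ => diagCrossingProb_two_le_siteCrossingProb R δ
  have hhi : ∀ᶠ δ in 𝓝[>] (0 : ℝ), siteCrossingProb R δ ≤ diagCrossingProb R 3 δ := by
    have hI : Ioo (0 : ℝ) (ε / 4) ∈ 𝓝[>] (0 : ℝ) := Ioo_mem_nhdsGT (by positivity)
    filter_upwards [hI] with δ hδ
    refine siteCrossingProb_le_diagCrossingProb_three R hδ.1 fun a ha b hb => ?_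
    have := hεd a ha b hb
    linarith [hδ.2]
  exact tendsto_of_tendsto_of_tendsto_of_le_of_le' (h2 R φ x hux) (h3 R φ x hux) hlo hhi

/-! ### The transferred crux C⁺ implies the crux -/

/-- **C⁺ ⇒ crux** (registered stub `stub_crux_of_voronoiToRandomDiagonal` of the line
`centre-decimation`): if Cardy's formula for annealed Poisson–Voronoi percolation implies Cardy's
formula for the annealed random-diagonal square lattice at the slacks `2δ` and `3δ`, then the crux
`CardyFlipRusso.SquareFromVoronoiHub` holds — by (CD) and the squeeze.  The antecedent C⁺ is the
crux's open universality content and is not proved in the tree. [cite: Rolla2019, §1] -/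
theorem stub_crux_of_voronoiToRandomDiagonal :
    ((∀ (PB PW : Measure (PointConfig ℂ)),
        IsPoissonPointProcess (volume : Measure ℂ) PB → IsPoissonPointProcess (volume : Measure ℂ) PW →
        ∀ R : ConformalRectangle, R.HasCrossingLimit (voronoiCrossingProb PB PW R) cardyFunction) →
      (∀ R : ConformalRectangle, R.HasCrossingLimit (diagCrossingProb R 2) cardyFunction) ∧
      (∀ R : ConformalRectangle, R.HasCrossingLimit (diagCrossingProb R 3) cardyFunction)) →
    Summit.CriticalPhenomena.CardyFormulaZ2.Theses.CardyFlipRusso.SquareFromVoronoiHub := by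
  intro hC
  rw [VoronoiBlocks.squareFromVoronoiHub_iff]
  intro hV
  exact gsCardy_of_randomDiagonalCardy (hC hV).1 (hC hV).2

end Summit.CriticalPhenomena.CardyFormulaZ2.Cruxes.SquareFromVoronoiHub.CentreDecimation

end
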